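import Summits.Ventures.HodgeKum4.Theses.KummerFixedLocus
import Summits.Ventures.HodgeKum4.Theorems.KummerFixedLocusTranslationGroup
import HarnessLib

/-!
# Route items F_Γ / F_Γ′ of `KummerFixedLocus`, CONDITIONAL closers (cell `hodge-kum4`, seat p2)

HONEST FRAMING.  The route decls `Theses.KummerFixedLocus.Kum4TranslationGroup` (F_Γ) and
`Theses.KummerFixedLocus.Kum4TranslationGroupTrivialOffMiddle` (F_Γ′) are PRINT INPUTS: they follow,
by unfolding, from the two Literature named facts `Hyperkaehler.Floccari2026_card_autFixingH2H3_kum4Type`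
(`|Γ(X)| = 625`) and `Hyperkaehler.Foster2024_translationAction_kum4Type` (Γ-regular middle, Γ trivial
off degree `8`).  The theorems below take those facts as hypotheses — CONDITIONAL results (the gate
records `conditional-result`; the items do not close as `proved` while the printed facts are unproved
in the tree).
-/

noncomputable section

namespace Summit.Ventures.HodgeKum4

/-- **F_Γ, conditional on print**: the route decl `Kum4TranslationGroup` from the two Literature facts. -/
theorem Kum4TranslationGroup_of_facts
    (h₁ : Literature.AlgebraicGeometry.Hyperkaehler.Floccari2026_card_autFixingH2H3_kum4Type)
    (h₂ : Literature.AlgebraicGeometry.Hyperkaehler.Foster2024_translationAction_kum4Type) :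
    Summit.Ventures.HodgeKum4.Theses.KummerFixedLocus.Kum4TranslationGroup := by
  unfold Summit.Ventures.HodgeKum4.Theses.KummerFixedLocus.Kum4TranslationGroup
  exact kum4TranslationGroup_of_literature h₁ h₂

/-- **F_Γ′, conditional on print**: the route decl `Kum4TranslationGroupTrivialOffMiddle` from Foster's
fact. -/
theorem Kum4TranslationGroupTrivialOffMiddle_of_facts
    (h₂ : Literature.AlgebraicGeometry.Hyperkaehler.Foster2024_translationAction_kum4Type) :
    Summit.Ventures.HodgeKum4.Theses.KummerFixedLocus.Kum4TranslationGroupTrivialOffMiddle := by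
  unfold Summit.Ventures.HodgeKum4.Theses.KummerFixedLocus.Kum4TranslationGroupTrivialOffMiddle
  exact kum4TranslationGroupTrivialOffMiddle_of_literature h₂

end Summit.Ventures.HodgeKum4

end
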